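import Literature.Probability.Percolation.BondTriangularCriticalPointProofs
import HarnessLib

/-!
# Route CardyBondTriangular · crux `BondTriangularCardy` (stmt-CriticalPhenomena-4664), line `birth`:
# the quantitative one-arm bound from upper box-crossing bounds

Helper of stub `stub_threeArmSmall` (Bollobás–Riordan's (12) on compacta for critical bond-`𝕋`).
The tree proves Grimmett–Manolescu's Proposition 23 (b) (Ann. Probab. 41 (2013) §4.1: upper
bounds on short-way strip crossings force `θ = 0`) for an arbitrary graph drawn in the plane with
short edges and locally finite vertex set under an independent bond model
(`Literature.Probability.Percolation.prodBernoulli_percolatesAt_eq_zero_of_upperBounds`,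
`BondTriangularCriticalPointProofs`). Its proof in fact establishes the QUANTITATIVE statement of
Proposition 23 (a) — "there exist `a, β > 0` such that `P_p(rad(C_v) ≥ k) ≤ a k^{-β}`": an open path
from the box `Λ_{R₀}(w)` (`R₀ = n₀ + 3`) to sup-norm distance `3 R₀ 5^K` from `w` crosses the
`K + 1` annuli at scales `R₀ 5^k`, `k ≤ K`, each crossed with probability `≤ 1 - c⁴` (Harris),
independently (disjoint edge sets), so its probability is `≤ (1 - c⁴)^{K+1}`, uniformly in the
centre `w ∈ ℂ`. This file extracts that bound (`prodBernoulli_real_arm_le_of_upperBounds`: Steps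
0–8 of the tree's proof verbatim with an arbitrary centre, Steps 9–10 replaced by the arm event)
and specialises it to bond percolation on the triangular lattice drawn by `triEmbed`
(`bondTriArm_le_of_upperBounds`, the registered helper signature).

References: G. R. Grimmett, I. Manolescu, Ann. Probab. 41 (2013) 2990–3025 = arXiv:1105.5535,
§4.1 Proposition 23 (a)–(b) and Remark 25 [GrimmettManolescuAOP2013]; G. Grimmett, *Percolation*,
2nd ed. (1999), Thm. (2.4) [Grimmett1999].
-/

noncomputable section

namespace Summit.CriticalPhenomena.CardyFormulaZ2.Theorems

open MeasureTheory Filter Topology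
open Literature.Probability.Percolation Literature.Probability.LatticeModels
open Literature.Probability.Percolation.IsoradialCriticality

/-- **The one-arm bound of Grimmett–Manolescu's Proposition 23 (a), quantitative form, for a graph
drawn in the plane.** Let `G` be a graph on a countable vertex set drawn by `z : V → ℂ` with
(i) both coordinates changing by `< 2` along every edge and (ii) finitely many vertices in every
sup-norm box, under an independent bond model `prodBernoulli q` vanishing off `E(G)`; suppose the
`(n/4) × n` rectangles are crossed horizontally and the `n × (n/4)` rectangles vertically with
probability `≤ 1 - c` (`0 < c`) for all `n ≥ n₀` and all translations. Then for every centre `p ∈ ℂ`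
and every `K`, an open path from the box `Λ_{n₀+3}(p)` to sup-norm distance `≥ 3 (n₀+3) 5^K` from
`p` has probability at most `(1 - c⁴)^{K+1}` (the `K + 1` annuli at scales `(n₀+3) 5^k`, `k ≤ K`,
are each crossed with probability `≤ 1 - c⁴` by Harris' inequality, independently).
[cite: GrimmettManolescuAOP2013, §4.1 Proposition 23 (a) and Remark 25 (arXiv:1105.5535 numbering)] -/
theorem prodBernoulli_real_arm_le_of_upperBounds {V : Type*} [Countable V] {G : SimpleGraph V}
    (q : Sym2 V → unitInterval) (hq : ∀ e, e ∉ G.edgeSet → q e = 0) (z : V → ℂ)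
    (hshort : ∀ ⦃u v : V⦄, G.Adj u v → |(z u).re - (z v).re| < 2 ∧ |(z u).im - (z v).im| < 2)
    (hfin : ∀ (w : ℂ) (R : ℝ), {v : V | (z v - w).boxNorm ≤ R}.Finite)
    {c : ℝ} (hc : 0 < c) {n₀ : ℕ} (hbd0 : ∀ n : ℕ, n₀ ≤ n → ∀ w : ℂ,
      (prodBernoulli q).real (embRectCrossing (fun v => z v - w) ((1 / 4 : ℝ) * n) n) ≤ 1 - c ∧
        (prodBernoulli q).real (embTBCrossing (fun v => z v - w) n ((1 / 4 : ℝ) * n)) ≤ 1 - c)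
    (p : ℂ) (K : ℕ) :
    (prodBernoulli q).real {ω | ∃ u v : V, (openGraph ω).Reachable u v ∧
        (z u - p).boxNorm ≤ n₀ + 3 ∧ 3 * (n₀ + 3) * 5 ^ K ≤ (z v - p).boxNorm} ≤
      (1 - c ^ 4) ^ (K + 1) := by
  classical
  set μ := prodBernoulli q with hμdef
  have hμ : μ = prodBernoulli q := rfl
  set A : Set (BondConfig V) := {ω | ∃ u v : V, (openGraph ω).Reachable u v ∧
    (z u - p).boxNorm ≤ n₀ + 3 ∧ 3 * (n₀ + 3) * 5 ^ K ≤ (z v - p).boxNorm} with hAdef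
  /- Step 0: discard the null set of configurations using non-edges of `G`. -/
  set good : Set (BondConfig V) := {ω | ω ⊆ G.edgeSet} with hgood_def
  have hN0 : μ {ω : BondConfig V | ¬ ω ⊆ G.edgeSet} = 0 := by
    have hset : {ω : BondConfig V | ¬ ω ⊆ G.edgeSet} = ⋃ e ∈ (G.edgeSet)ᶜ, {ω | e ∈ ω} := by
      ext ω
      simp only [Set.mem_setOf_eq, Set.not_subset, Set.mem_iUnion, Set.mem_compl_iff,
        exists_prop]
      exact ⟨fun ⟨e, he, hne⟩ => ⟨e, hne, he⟩, fun ⟨e, hne, he⟩ => ⟨e, he, hne⟩⟩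
    rw [hset, measure_biUnion_null_iff (Set.to_countable _)]
    intro e he
    have h := prodBernoulli_real_setOf_mem q e
    rw [hq e he] at h
    have h0 : μ.real {ω | e ∈ ω} = 0 := by rw [hμ, h]; rfl
    exact (measureReal_eq_zero_iff (measure_ne_top _ _)).1 h0
  suffices hgood : μ.real (A ∩ good) ≤ (1 - c ^ 4) ^ (K + 1) by
    calc μ.real A ≤ μ.real (A ∩ good ∪ {ω : BondConfig V | ¬ ω ⊆ G.edgeSet}) :=
          measureReal_mono fun ω hω => by
            by_cases h : ω ⊆ G.edgeSet
            · exact Or.inl ⟨hω, h⟩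
            · exact Or.inr h
      _ ≤ μ.real (A ∩ good) + μ.real {ω : BondConfig V | ¬ ω ⊆ G.edgeSet} :=
          measureReal_union_le _ _
      _ = μ.real (A ∩ good) := by
          rw [(measureReal_eq_zero_iff (measure_ne_top μ _)).2 hN0, add_zero]
      _ ≤ (1 - c ^ 4) ^ (K + 1) := hgood
  /- Step 2: the re-centred drawing, local finiteness, short open edges. -/
  set z' : V → ℂ := fun v => z v - p with hz'
  have hfin' : ∀ R : ℝ, {v : V | (z' v).boxNorm ≤ R}.Finite := fun R => hfin p R
  have hH : ∀ {ω : BondConfig V}, ω ⊆ G.edgeSet → ∀ ⦃a b : V⦄, (openGraph ω).Adj a b →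
      |(z' a).re - (z' b).re| < 2 ∧ |(z' a).im - (z' b).im| < 2 := by
    intro ω hω a b hab
    rw [openGraph_adj] at hab
    have := hshort (hω hab.1 : G.Adj a b)
    simpa [hz'] using this
  /- Step 3: the four strip events at scale `r` (shape of `BoxCrossingBounds` with `ρ = 1/4`,
  `n = 8r`), their union, and the annulus of vertices carrying them. -/
  set strip : ℕ → Fin 4 → Set (BondConfig V) := fun r =>
    ![embRectCrossing (fun v => z' v - ⟨(r : ℝ), -(4 * (r : ℝ))⟩)
        ((1 / 4 : ℝ) * ((8 * r : ℕ) : ℝ)) ((8 * r : ℕ) : ℝ),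
      embRectCrossing (fun v => z' v - ⟨-(3 * (r : ℝ)), -(4 * (r : ℝ))⟩)
        ((1 / 4 : ℝ) * ((8 * r : ℕ) : ℝ)) ((8 * r : ℕ) : ℝ),
      embTBCrossing (fun v => z' v - ⟨-(4 * (r : ℝ)), (r : ℝ)⟩)
        ((8 * r : ℕ) : ℝ) ((1 / 4 : ℝ) * ((8 * r : ℕ) : ℝ)),
      embTBCrossing (fun v => z' v - ⟨-(4 * (r : ℝ)), -(3 * (r : ℝ))⟩)
        ((8 * r : ℕ) : ℝ) ((1 / 4 : ℝ) * ((8 * r : ℕ) : ℝ))] with hstrip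
  set U : ℕ → Set (BondConfig V) := fun r => ⋃ i, strip r i with hUdef
  set region : ℕ → Set V := fun r =>
    {v | (r : ℝ) - 2 ≤ (z' v).boxNorm ∧ (z' v).boxNorm ≤ 4 * r} with hregion
  have h8 : ∀ r : ℕ, ((8 * r : ℕ) : ℝ) = 8 * r := fun r => by push_cast; ring
  -- each strip is an open-crossing event inside `region r`
  have hstripS : ∀ {r : ℕ}, 2 ≤ r → ∀ i : Fin 4,
      ∃ S A B : Set V, strip r i = openCrossing S A B ∧ S ⊆ region r := by
    intro r hr i
    have hr' : (2 : ℝ) ≤ r := by exact_mod_cast hr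
    have h8r := h8 r
    fin_cases i
    · refine ⟨_, _, _, rfl, ?_⟩
      rintro v ⟨⟨h1, h2⟩, ⟨h3, h4⟩⟩
      simp only [Complex.sub_re, Complex.sub_im, h8r] at h1 h2 h3 h4
      refine ⟨?_, ?_⟩
      · exact le_trans (by linarith) ((le_abs_self _).trans (abs_re_le_boxNorm (z' v)))
      · unfold Complex.boxNorm
        exact max_le (abs_le.2 ⟨by linarith, by linarith⟩) (abs_le.2 ⟨by linarith, by linarith⟩)
    · refine ⟨_, _, _, rfl, ?_⟩
      rintro v ⟨⟨h1, h2⟩, ⟨h3, h4⟩⟩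
      simp only [Complex.sub_re, Complex.sub_im, h8r] at h1 h2 h3 h4
      refine ⟨?_, ?_⟩
      · exact le_trans (by linarith) ((neg_le_abs _).trans (abs_re_le_boxNorm (z' v)))
      · unfold Complex.boxNorm
        exact max_le (abs_le.2 ⟨by linarith, by linarith⟩) (abs_le.2 ⟨by linarith, by linarith⟩)
    · refine ⟨_, _, _, rfl, ?_⟩
      rintro v ⟨⟨h1, h2⟩, ⟨h3, h4⟩⟩
      simp only [Complex.sub_re, Complex.sub_im, h8r] at h1 h2 h3 h4
      refine ⟨?_, ?_⟩
      · exact le_trans (by linarith) ((le_abs_self _).trans (abs_im_le_boxNorm (z' v)))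
      · unfold Complex.boxNorm
        exact max_le (abs_le.2 ⟨by linarith, by linarith⟩) (abs_le.2 ⟨by linarith, by linarith⟩)
    · refine ⟨_, _, _, rfl, ?_⟩
      rintro v ⟨⟨h1, h2⟩, ⟨h3, h4⟩⟩
      simp only [Complex.sub_re, Complex.sub_im, h8r] at h1 h2 h3 h4
      refine ⟨?_, ?_⟩
      · exact le_trans (by linarith) ((neg_le_abs _).trans (abs_im_le_boxNorm (z' v)))
      · unfold Complex.boxNorm
        exact max_le (abs_le.2 ⟨by linarith, by linarith⟩) (abs_le.2 ⟨by linarith, by linarith⟩)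
  -- the strips are increasing events
  have hupper : ∀ r i, IsUpperSet (strip r i) := by
    intro r i
    fin_cases i
    · exact isUpperSet_embRectCrossing _ _ _
    · exact isUpperSet_embRectCrossing _ _ _
    · exact isUpperSet_embTBCrossing _ _ _
    · exact isUpperSet_embTBCrossing _ _ _
  -- an open path from `Λ_r(p)` to sup-norm distance `3r` crosses one of the four strips
  have hmemU : ∀ {ω : BondConfig V}, ω ⊆ G.edgeSet → ∀ {r : ℕ}, 2 ≤ r →
      ∀ {u v : V} (w : (openGraph ω).Walk u v),
        (z' u).boxNorm ≤ r → 3 * (r : ℝ) ≤ (z' v).boxNorm → ω ∈ U r := by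
    intro ω hω r hr u v w hu hv
    have hr' : (2 : ℝ) ≤ r := by exact_mod_cast hr
    have h8r := h8 r
    have hrL : (r : ℝ) < 3 * r := by linarith
    obtain ⟨a, b, W, hcase⟩ := exists_strip_crossing z' (hH hω) hrL w hu hv
    simp only [hUdef, Set.mem_iUnion]
    rcases hcase with ⟨ha, hb, hW⟩ | ⟨ha, hb, hW⟩ | ⟨ha, hb, hW⟩ | ⟨ha, hb, hW⟩
    · -- right strip
      refine ⟨0, a, ?_, b, ?_, mem_openConnIn_iff_exists_openWalk.2 ⟨W, fun t ht => ?_⟩⟩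
      · show (z' a - _).re ≤ 0
        simp only [Complex.sub_re]; linarith
      · show (1 / 4 : ℝ) * ((8 * r : ℕ) : ℝ) ≤ (z' b - _).re
        simp only [Complex.sub_re, h8r]; linarith
      · obtain ⟨h1, h2, h3⟩ := hW t ht
        have h3' := abs_le.1 h3
        show (z' t - _).re ∈ Set.Icc (-2 : ℝ) _ ∧ (z' t - _).im ∈ Set.Icc (0 : ℝ) _
        simp only [Complex.sub_re, Complex.sub_im, h8r, Set.mem_Icc]
        exact ⟨⟨by linarith, by linarith⟩, ⟨by linarith, by linarith⟩⟩
    · -- left strip (walk reversed: from `b` in `{re ≤ -3r}` to `a` in `{-r ≤ re}`)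
      refine ⟨1, b, ?_, a, ?_, mem_openConnIn_iff_exists_openWalk.2 ⟨W.reverse, fun t ht => ?_⟩⟩
      · show (z' b - _).re ≤ 0
        simp only [Complex.sub_re]; linarith
      · show (1 / 4 : ℝ) * ((8 * r : ℕ) : ℝ) ≤ (z' a - _).re
        simp only [Complex.sub_re, h8r]; linarith
      · rw [SimpleGraph.Walk.support_reverse, List.mem_reverse] at ht
        obtain ⟨h1, h2, h3⟩ := hW t ht
        have h3' := abs_le.1 h3
        show (z' t - _).re ∈ Set.Icc (-2 : ℝ) _ ∧ (z' t - _).im ∈ Set.Icc (0 : ℝ) _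
        simp only [Complex.sub_re, Complex.sub_im, h8r, Set.mem_Icc]
        exact ⟨⟨by linarith, by linarith⟩, ⟨by linarith, by linarith⟩⟩
    · -- top strip
      refine ⟨2, a, ?_, b, ?_, mem_openConnIn_iff_exists_openWalk.2 ⟨W, fun t ht => ?_⟩⟩
      · show (z' a - _).im ≤ 0
        simp only [Complex.sub_im]; linarith
      · show (1 / 4 : ℝ) * ((8 * r : ℕ) : ℝ) ≤ (z' b - _).im
        simp only [Complex.sub_im, h8r]; linarith
      · obtain ⟨h1, h2, h3⟩ := hW t ht
        have h3' := abs_le.1 h3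
        show (z' t - _).re ∈ Set.Icc (0 : ℝ) _ ∧ (z' t - _).im ∈ Set.Icc (-2 : ℝ) _
        simp only [Complex.sub_re, Complex.sub_im, h8r, Set.mem_Icc]
        exact ⟨⟨by linarith, by linarith⟩, ⟨by linarith, by linarith⟩⟩
    · -- bottom strip (walk reversed)
      refine ⟨3, b, ?_, a, ?_, mem_openConnIn_iff_exists_openWalk.2 ⟨W.reverse, fun t ht => ?_⟩⟩
      · show (z' b - _).im ≤ 0
        simp only [Complex.sub_im]; linarith
      · show (1 / 4 : ℝ) * ((8 * r : ℕ) : ℝ) ≤ (z' a - _).im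
        simp only [Complex.sub_im, h8r]; linarith
      · rw [SimpleGraph.Walk.support_reverse, List.mem_reverse] at ht
        obtain ⟨h1, h2, h3⟩ := hW t ht
        have h3' := abs_le.1 h3
        show (z' t - _).re ∈ Set.Icc (0 : ℝ) _ ∧ (z' t - _).im ∈ Set.Icc (-2 : ℝ) _
        simp only [Complex.sub_re, Complex.sub_im, h8r, Set.mem_Icc]
        exact ⟨⟨by linarith, by linarith⟩, ⟨by linarith, by linarith⟩⟩
  /- Step 4: the upper crossing bounds at aspect ratio `1/4`, for the re-centred drawing. -/
  have hbd : ∀ n : ℕ, n₀ ≤ n → ∀ w : ℂ,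
      μ.real (embRectCrossing (fun v => z' v - w) ((1 / 4 : ℝ) * n) n) ≤ 1 - c ∧
        μ.real (embTBCrossing (fun v => z' v - w) n ((1 / 4 : ℝ) * n)) ≤ 1 - c := by
    intro n hn w
    have h := hbd0 n hn (p + w)
    have hfun : (fun v => z v - (p + w)) = fun v => z' v - w := by
      funext v; simp only [hz']; ring
    rw [hfun] at h
    exact h
  /- Step 5: the scales `r_k = R₀ 5^k`. -/
  set R₀ : ℕ := n₀ + 3 with hR₀
  set rk : ℕ → ℕ := fun k => R₀ * 5 ^ k with hrk
  have hrk3 : ∀ k, 3 ≤ rk k := fun k => by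
    have : 1 ≤ 5 ^ k := Nat.one_le_pow _ _ (by norm_num)
    simp only [hrk]; nlinarith
  have hrk2 : ∀ k, 2 ≤ rk k := fun k => (by norm_num : 2 ≤ 3).trans (hrk3 k)
  have hrkn : ∀ k, n₀ ≤ 8 * rk k := fun k => by
    have : 1 ≤ 5 ^ k := Nat.one_le_pow _ _ (by norm_num)
    simp only [hrk]; nlinarith
  have hrk5 : ∀ j k, j < k → 5 * rk j ≤ rk k := fun j k hjk => by
    simp only [hrk]
    calc 5 * (R₀ * 5 ^ j) = R₀ * 5 ^ (j + 1) := by ring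
      _ ≤ R₀ * 5 ^ k := Nat.mul_le_mul_left _ (Nat.pow_le_pow_right (by norm_num) hjk)
  have hrkR₀ : ∀ k, R₀ ≤ rk k := fun k => by
    have : 1 ≤ 5 ^ k := Nat.one_le_pow _ _ (by norm_num)
    simp only [hrk]; nlinarith
  have hrkmono : ∀ j k, j ≤ k → rk j ≤ rk k := fun j k hjk =>
    Nat.mul_le_mul_left _ (Nat.pow_le_pow_right (by norm_num) hjk)
  /- Step 6: the finite vertex sets carrying the strip events, pairwise disjoint. -/
  have hregfin : ∀ k, (region (rk k)).Finite := fun k =>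
    (hfin' (4 * (rk k : ℝ))).subset fun v hv => hv.2
  set T : ℕ → Finset V := fun k => (hregfin k).toFinset with hT
  have hTcoe : ∀ k, (↑(T k) : Set V) = region (rk k) := fun k =>
    Set.Finite.coe_toFinset _
  have hTdisj : ∀ j k, j ≠ k → Disjoint (T j) (T k) := by
    intro j k hjk
    wlog hlt : j < k generalizing j k
    · exact (this k j (Ne.symm hjk) (lt_of_le_of_ne (not_lt.1 hlt) (Ne.symm hjk))).symm
    rw [Finset.disjoint_left]
    intro v hvj hvk
    have hvj' : v ∈ region (rk j) := by rw [← hTcoe]; exact Finset.mem_coe.2 hvj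
    have hvk' : v ∈ region (rk k) := by rw [← hTcoe]; exact Finset.mem_coe.2 hvk
    have h5 : (5 : ℝ) * rk j ≤ rk k := by exact_mod_cast hrk5 j k hlt
    have h3 : (3 : ℝ) ≤ rk j := by exact_mod_cast hrk3 j
    linarith [hvj'.2, hvk'.1]
  have hdet : ∀ k, DeterminedBy (U (rk k)) (↑(T k).sym2 : Set (Sym2 V)) := by
    intro k
    refine determinedBy_iUnion fun i => ?_
    obtain ⟨S, A, B, hSe, hS⟩ := hstripS (hrk2 k) i
    rw [hSe]
    exact determinedBy_openCrossing_of_subset (by rw [hTcoe]; exact hS) A B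
  have hmeas : ∀ k i, MeasurableSet (strip (rk k) i) := by
    intro k i
    obtain ⟨S, A, B, hSe, hS⟩ := hstripS (hrk2 k) i
    rw [hSe]
    exact (determinedBy_openCrossing_of_subset (T := T k) (by rw [hTcoe]; exact hS) A B
      ).measurableSet_of_finset
  have hmeasU : ∀ k, MeasurableSet (U (rk k)) := fun k => (hdet k).measurableSet_of_finset
  /- Step 7: each annulus is crossed with probability at most `1 - c⁴` (Harris). -/
  have hU : ∀ k, μ.real (U (rk k)) ≤ 1 - c ^ 4 := by
    intro k
    rw [hμ]
    refine prodBernoulli_real_iUnion_le q (strip (rk k)) (hupper (rk k)) (hmeas k)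
      hc.le fun i => ?_
    have hb := hbd (8 * rk k) (hrkn k)
    fin_cases i
    · exact (hb _).1
    · exact (hb _).1
    · exact (hb _).2
    · exact (hb _).2
  /- Step 8: independence over the annuli. -/
  have hind : ∀ K : ℕ, μ.real (⋂ k ∈ Finset.range K, U (rk k)) =
      ∏ k ∈ Finset.range K, μ.real (U (rk k)) := by
    intro K
    have hPD : (↑(Finset.range K) : Set ℕ).PairwiseDisjoint fun k => (T k).sym2 :=
      fun j _ k _ hjk => disjoint_sym2_of_disjoint (hTdisj j k hjk)
    have h := prodBernoulli_real_inter_biInter_of_determinedBy q (Finset.range K)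
      (fun k => (T k).sym2) hPD (fun k _ => hdet k) (fun k _ => hmeasU k)
      (A := Set.univ) (determinedBy_univ _) MeasurableSet.univ
    rw [Set.univ_inter, probReal_univ, one_mul] at h
    rw [hμ]
    exact h
  /- Step 9: on the good set, the arm crosses the annuli `k ≤ K`. -/
  have hsub : A ∩ good ⊆ ⋂ k ∈ Finset.range (K + 1), U (rk k) := by
    intro ω hω
    obtain ⟨⟨u, v, ⟨w⟩, hu, hv⟩, hωE⟩ := hω
    simp only [Set.mem_iInter]
    intro k hk
    have hkK : k ≤ K := Nat.lt_succ_iff.1 (Finset.mem_range.1 hk)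
    refine hmemU hωE (hrk2 k) w ?_ ?_
    · have h1 : ((R₀ : ℕ) : ℝ) ≤ rk k := by exact_mod_cast hrkR₀ k
      have h2 : (z' u).boxNorm ≤ R₀ := by
        have : ((R₀ : ℕ) : ℝ) = n₀ + 3 := by simp only [hR₀]; push_cast; ring
        rw [this]; exact hu
      exact h2.trans h1
    · have h1 : ((rk k : ℕ) : ℝ) ≤ rk K := by exact_mod_cast hrkmono k K hkK
      have h2 : ((rk K : ℕ) : ℝ) = (n₀ + 3) * 5 ^ K := by simp only [hrk, hR₀]; push_cast; ring
      have h3 : 3 * ((rk K : ℕ) : ℝ) ≤ (z' v).boxNorm := by rw [h2, ← mul_assoc]; exact hv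
      linarith
  /- Step 10: conclusion. -/
  calc μ.real (A ∩ good)
      ≤ μ.real (⋂ k ∈ Finset.range (K + 1), U (rk k)) := measureReal_mono hsub
    _ = ∏ k ∈ Finset.range (K + 1), μ.real (U (rk k)) := hind (K + 1)
    _ ≤ ∏ _k ∈ Finset.range (K + 1), (1 - c ^ 4) :=
        Finset.prod_le_prod (fun _ _ => measureReal_nonneg) fun k _ => hU k
    _ = (1 - c ^ 4) ^ (K + 1) := by rw [Finset.prod_const, Finset.card_range]

/-- **The one-arm bound for bond percolation on the triangular lattice from upper box-crossing
bounds** (registered helper of stub `stub_threeArmSmall`): if Bernoulli bond percolation on `𝕋`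
with parameter `p` crosses the `(n/4) × n` rectangles of the `triEmbed`-plane horizontally and the
`n × (n/4)` rectangles vertically with probability `≤ 1 - c` (`0 < c`) for all `n ≥ n₀` and all
translations, then for every centre `w ∈ ℂ` and every `K` an open path of `𝕋` from the box
`Λ_{n₀+3}(w)` to sup-norm distance `≥ 3 (n₀+3) 5^K` from `w` has probability `≤ (1 - c⁴)^{K+1}`
(`prodBernoulli_real_arm_le_of_upperBounds` for the drawing `triEmbed`: edge length `1 < 2`,
locally finite). [cite: GrimmettManolescuAOP2013, §4.1 Proposition 23 (a) (arXiv:1105.5535 numbering)] -/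
theorem bondTriArm_le_of_upperBounds : ∀ (p : unitInterval) (c : ℝ), 0 < c → ∀ n₀ : ℕ, (∀ n : ℕ, n₀ ≤ n → ∀ w : ℂ, (Literature.Probability.Percolation.bondPercolation Literature.Probability.LatticeModels.triGraph p).real (Literature.Probability.LatticeModels.embRectCrossing (fun v => Literature.Probability.LatticeModels.triEmbed v - w) ((1 / 4 : ℝ) * n) n) ≤ 1 - c ∧ (Literature.Probability.Percolation.bondPercolation Literature.Probability.LatticeModels.triGraph p).real (Literature.Probability.LatticeModels.embTBCrossing (fun v => Literature.Probability.LatticeModels.triEmbed v - w) n ((1 / 4 : ℝ) * n)) ≤ 1 - c) → ∀ (w : ℂ) (K : ℕ), (Literature.Probability.Percolation.bondPercolation Literature.Probability.LatticeModels.triGraph p).real {ω | ∃ u v : Literature.Probability.LatticeModels.Site 2, (Literature.Probability.Percolation.openGraph ω).Reachable u v ∧ (Literature.Probability.LatticeModels.triEmbed u - w).boxNorm ≤ n₀ + 3 ∧ 3 * (n₀ + 3) * 5 ^ K ≤ (Literature.Probability.LatticeModels.triEmbed v - w).boxNorm} ≤ (1 - c ^ 4) ^ (K + 1) := by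
  intro p c hc n₀ hbd w K
  rw [bondPercolation_triGraph_eq_prodBernoulli] at hbd ⊢
  refine prodBernoulli_real_arm_le_of_upperBounds (G := triGraph) _ (fun e he => ?_) triEmbed
    (fun u v h => abs_triEmbed_sub_lt_two h) finite_setOf_boxNorm_triEmbed_sub_le hc hbd w K
  rw [if_neg he]

end Summit.CriticalPhenomena.CardyFormulaZ2.Theorems

end
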